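import Literature.Probability.LatticeModels.ThermodynamicLimit
import Mathlib.Analysis.SpecificLimits.Basic
import Mathlib.Topology.Algebra.InfiniteSum.ENNReal
import HarnessLib

/-!
# `PercSupergraphDichotomy.EnhancementThresholdLimit` (stmt-CriticalPhenomena-11903) — II: summing the star chains

RSW3 lane (lead, gen 31).  Helper lemmas for item `stmt-CriticalPhenomena-11903` (the critical points of the `m`-periodically
decorated lattices `D_m` tend to `p_c(ℤ³)`).  PURE ANALYSIS on `ℤ³` for an arbitrary translation-invariant kernel
`T(v − u) ∈ [0, ∞]` (in the application `T(v) = τ_p(0, v)`, `p < p_c(ℤ³)`): the total weight of the Aizenman–Newman star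
chains of `…EnhancementThresholdLimitChains` — `k` decorated sites `x_i ∈ mℤ³`, no two consecutive equal, cube sites
`a_i, b_i ∈ Q(x_i)`, weight `T(a_0 − s) · Π T(a_{i+1} − b_i) · T(z − b_{k−1})`, summed over the chain and the endpoint `z` — is
at most `χ (729 ε_m)^k` when the first star must differ from a decorated `x_p ∋ s` (`levelSum_le_pow`) and at most
`729 χ · χ (729 ε_m)^k` for `k + 1` stars from an arbitrary start (`levelSum_succ_le`), where `χ = Σ_v T(v)` and
`ε_m = Σ_{v ∉ Λ_{m−3}} T(v)`: two distinct decorated sites differ by `≥ m` in some coordinate, so every inner link pays the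
TAIL `ε_m` (`not_mem_box_of_ne`, `tsum_firstStar_le`), each cube has `≤ 27` sites (`tsum_indicator_cube_le`), and the
chain conditions/weights split off their first star under `Fin.cons` (`chainCond_cons_iff`, `chainWeight_cons`,
`levelSum_succ`, `levelSum_zero`).  No definitions, no sorries; the chain weight is written out in each statement
(`Fin`-indexed triples `(x_i, a_i, b_i)`, indicator of the chain conditions).
Reference: M. Aizenman, C. M. Newman, J. Stat. Phys. 36 (1984) §4 (cluster-of-clusters bound) [AizenmanNewman1984].
-/

noncomputable section

namespace Summit.CriticalPhenomena.PercolationContinuityZ3.Theorems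

namespace EnhancementThresholdLimit

open Finset Literature.Probability.LatticeModels
open scoped ENNReal Classical

/-! ### Counting cube sites and the tail of the kernel -/

/-- A unit cube of `ℤ³` has at most `27` sites: `Σ_x 1[∀ j, |a_j − x_j| ≤ 1] ≤ 27`. [folklore] -/
theorem tsum_indicator_cube_le (a : Site 3) :
    ∑' x : Site 3, (if ∀ j, |x j - a j| ≤ 1 then (1 : ℝ≥0∞) else 0) ≤ 27 := by
  classical
  have hsupp : ∀ x ∉ (box 3 1).image (fun v => a - v), (if ∀ j, |x j - a j| ≤ 1 then (1 : ℝ≥0∞) else 0) = 0 := by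
    intro x hx
    rw [if_neg]
    intro hcube
    apply hx
    rw [Finset.mem_image]
    refine ⟨a - x, ?_, by abel⟩
    rw [mem_box]
    intro j
    have h := hcube j
    rw [abs_le] at h
    rw [Pi.sub_apply]
    push_cast
    exact ⟨by linarith [h.1], by linarith [h.2]⟩
  rw [tsum_eq_sum hsupp]
  calc ∑ x ∈ (box 3 1).image (fun v => a - v), (if ∀ j, |x j - a j| ≤ 1 then (1 : ℝ≥0∞) else 0)
      ≤ ∑ _x ∈ (box 3 1).image (fun v => a - v), (1 : ℝ≥0∞) :=
        Finset.sum_le_sum fun x _ => by split_ifs <;> simp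
    _ = (((box 3 1).image (fun v => a - v)).card : ℝ≥0∞) := by rw [Finset.sum_const, Nat.smul_one_eq_cast]
    _ ≤ ((box 3 1).card : ℝ≥0∞) := by exact_mod_cast Finset.card_image_le
    _ = 27 := by rw [card_box]; norm_num

/-- **Distinct decorated sites are far apart**: if `x_p ≠ x₀` both lie in `mℤ³` (`m ≥ 3`), `s ∈ Q(x_p)` and `a ∈ Q(x₀)`,
then `a − s ∉ Λ_{m−3}`. [folklore] -/
theorem not_mem_box_of_ne {m : ℕ} (hm : 3 ≤ m) {xp x₀ s a : Site 3} (hxp : ∀ j, (m : ℤ) ∣ xp j)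
    (hx₀ : ∀ j, (m : ℤ) ∣ x₀ j) (hne : x₀ ≠ xp) (hs : ∀ j, |s j - xp j| ≤ 1) (ha : ∀ j, |a j - x₀ j| ≤ 1) :
    a - s ∉ box 3 (m - 3) := by
  obtain ⟨j, hj⟩ : ∃ j, x₀ j ≠ xp j := by
    by_contra h
    push Not at h
    exact hne (funext h)
  have hdvd : (m : ℤ) ∣ x₀ j - xp j := dvd_sub (hx₀ j) (hxp j)
  have hle := Int.natAbs_le_of_dvd_ne_zero hdvd (sub_ne_zero.2 hj)
  simp only [Int.natAbs_natCast] at hle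
  have h1 := hs j
  have h2 := ha j
  rw [abs_le] at h1 h2
  intro hmem
  rw [mem_box] at hmem
  have h3 := hmem j
  rw [Pi.sub_apply] at h3
  push_cast [Nat.cast_sub hm] at h3
  omega

/-! ### The chain weight and its first-link decomposition -/

/-- First-link decomposition of the chain CONDITIONS under `Fin.cons`. [folklore] -/
theorem chainCond_cons_iff {m k : ℕ} (R : Site 3 → Prop) (c₀ : Site 3 × Site 3 × Site 3)
    (c : Fin k → Site 3 × Site 3 × Site 3) :
    ((∀ i : Fin (k + 1), (∀ j, (m : ℤ) ∣ ((Fin.cons c₀ c : Fin (k + 1) → Site 3 × Site 3 × Site 3) i).1 j) ∧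
        (∀ j, |((Fin.cons c₀ c : Fin (k + 1) → Site 3 × Site 3 × Site 3) i).2.1 j -
          ((Fin.cons c₀ c : Fin (k + 1) → Site 3 × Site 3 × Site 3) i).1 j| ≤ 1) ∧
        (∀ j, |((Fin.cons c₀ c : Fin (k + 1) → Site 3 × Site 3 × Site 3) i).2.2 j -
          ((Fin.cons c₀ c : Fin (k + 1) → Site 3 × Site 3 × Site 3) i).1 j| ≤ 1)) ∧
      (∀ (i : Fin (k + 1)) (h : i.1 + 1 < k + 1),
        ((Fin.cons c₀ c : Fin (k + 1) → Site 3 × Site 3 × Site 3) i).1 ≠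
          ((Fin.cons c₀ c : Fin (k + 1) → Site 3 × Site 3 × Site 3) ⟨i.1 + 1, h⟩).1) ∧
      (∀ h : 0 < k + 1, R ((Fin.cons c₀ c : Fin (k + 1) → Site 3 × Site 3 × Site 3) ⟨0, h⟩).1)) ↔
    (((∀ j, (m : ℤ) ∣ c₀.1 j) ∧ (∀ j, |c₀.2.1 j - c₀.1 j| ≤ 1) ∧ (∀ j, |c₀.2.2 j - c₀.1 j| ≤ 1) ∧ R c₀.1) ∧
    ((∀ i : Fin k, (∀ j, (m : ℤ) ∣ (c i).1 j) ∧ (∀ j, |(c i).2.1 j - (c i).1 j| ≤ 1) ∧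
        (∀ j, |(c i).2.2 j - (c i).1 j| ≤ 1)) ∧
      (∀ (i : Fin k) (h : i.1 + 1 < k), (c i).1 ≠ (c ⟨i.1 + 1, h⟩).1) ∧
      (∀ h : 0 < k, (c ⟨0, h⟩).1 ≠ c₀.1))) := by
  have e0 : ∀ h : 0 < k + 1, ((Fin.cons c₀ c : Fin (k + 1) → Site 3 × Site 3 × Site 3) ⟨0, h⟩) = c₀ := fun h => rfl
  have es : ∀ (i : ℕ) (h : i + 1 < k + 1),
      ((Fin.cons c₀ c : Fin (k + 1) → Site 3 × Site 3 × Site 3) ⟨i + 1, h⟩) = c ⟨i, by omega⟩ := fun i h => rfl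
  constructor
  · rintro ⟨hall, hcons, hR⟩
    refine ⟨⟨?_, ?_, ?_, ?_⟩, ⟨fun i => ?_, fun i h => ?_, fun h => ?_⟩⟩
    · have := (hall ⟨0, by omega⟩).1; rwa [e0] at this
    · have := (hall ⟨0, by omega⟩).2.1; rwa [e0] at this
    · have := (hall ⟨0, by omega⟩).2.2; rwa [e0] at this
    · have := hR (by omega); rwa [e0] at this
    · have := hall ⟨i.1 + 1, by omega⟩
      rwa [es i.1 (by omega)] at this
    · have := hcons ⟨i.1 + 1, by omega⟩ (by simp only; omega)
      rwa [es i.1 (by omega), es (i.1 + 1) (by omega)] at this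
    · have := hcons ⟨0, by omega⟩ (by simp only; omega)
      rw [e0, es 0 (by omega)] at this
      exact fun h' => this h'.symm
  · rintro ⟨⟨hd, ha, hb, hR⟩, hall, hcons, hfirst⟩
    refine ⟨fun i => ?_, fun i h => ?_, fun h => by rw [e0]; exact hR⟩
    · obtain ⟨n, hn⟩ := i
      cases n with
      | zero => rw [e0]; exact ⟨hd, ha, hb⟩
      | succ n => rw [es n hn]; exact hall ⟨n, by omega⟩
    · obtain ⟨n, hn⟩ := i
      cases n with
      | zero =>
          rw [e0]
          have h1 : (0 : ℕ) + 1 < k + 1 := h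
          rw [es 0 h1]
          exact fun h' => hfirst (by omega) h'.symm
      | succ n =>
          have h1 : n + 1 + 1 < k + 1 := h
          rw [es n hn, es (n + 1) h1]
          exact hcons ⟨n, by omega⟩ (by simp only; omega)

/-- First-link decomposition of the chain WEIGHT under `Fin.cons`:
`W_{k+1}(s; c₀ :: c; z) = T(a₀ − s) · W_k(b₀; c; z)`. [folklore] -/
theorem chainWeight_cons (T : Site 3 → ℝ≥0∞) {k : ℕ} (s z : Site 3) (c₀ : Site 3 × Site 3 × Site 3)
    (c : Fin k → Site 3 × Site 3 × Site 3) :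
    (∏ i : Fin (k + 2),
        T ((if h : i.1 < k + 1 then ((Fin.cons c₀ c : Fin (k + 1) → Site 3 × Site 3 × Site 3) ⟨i.1, h⟩).2.1 else z) -
          (if _h : i.1 = 0 then s else
            ((Fin.cons c₀ c : Fin (k + 1) → Site 3 × Site 3 × Site 3) ⟨i.1 - 1, by omega⟩).2.2))) =
      T (c₀.2.1 - s) *
        ∏ i : Fin (k + 1), T ((if h : i.1 < k then (c ⟨i.1, h⟩).2.1 else z) -
          (if h : i.1 = 0 then c₀.2.2 else (c ⟨i.1 - 1, by omega⟩).2.2)) := by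
  rw [Fin.prod_univ_succ]
  refine congrArg₂ (· * ·) rfl ?_
  · refine Finset.prod_congr rfl fun i _ => ?_
    have hv : (i.succ : Fin (k + 2)).1 = i.1 + 1 := rfl
    congr 1
    congr 1
    · by_cases hik : i.1 < k
      · rw [dif_pos (by rw [hv]; omega), dif_pos hik]
        rfl
      · rw [dif_neg (by rw [hv]; omega), dif_neg hik]
    · rw [dif_neg (by rw [hv]; omega)]
      by_cases hi0 : i.1 = 0
      · rw [dif_pos hi0]
        have : (⟨(i.succ : Fin (k + 2)).1 - 1, by rw [hv]; omega⟩ : Fin (k + 1)) = 0 := Fin.ext (by simp [hi0])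
        rw [this]
        rfl
      · rw [dif_neg hi0]
        obtain ⟨i₀, hi₀⟩ : ∃ i₀ : ℕ, i.1 = i₀ + 1 := ⟨i.1 - 1, by omega⟩
        have h1 : (⟨(i.succ : Fin (k + 2)).1 - 1, by rw [hv]; omega⟩ : Fin (k + 1)) = ⟨i₀ + 1, by omega⟩ :=
          Fin.ext (by simp [hi₀])
        have h2 : (⟨i.1 - 1, by omega⟩ : Fin k) = ⟨i₀, by omega⟩ := Fin.ext (by simp [hi₀])
        rw [h1, h2]
        rfl

/-! ### The first star of a chain: the cube count and the tail -/

/-- **The first star of a chain**: if every admissible first star `(x₀, a₀, b₀)` (`x₀ ∈ mℤ³` with `R x₀`, `a₀, b₀ ∈ Q(x₀)`)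
has `T(a₀ − s) ≤ g(a₀ − s)`, then the total first-link weight is at most `27 · 27 · Σ_v g(v)` (`27` choices of `b₀`, and
at most `27` decorated cubes through each `a₀`). [cite: AizenmanNewman1984, §4] -/
theorem tsum_firstStar_le_of (T g : Site 3 → ℝ≥0∞) (m : ℕ) (R : Site 3 → Prop) (s : Site 3)
    (hg : ∀ x₀ a₀ : Site 3, (∀ j, (m : ℤ) ∣ x₀ j) → (∀ j, |a₀ j - x₀ j| ≤ 1) → R x₀ → T (a₀ - s) ≤ g (a₀ - s)) :
    ∑' c₀ : Site 3 × Site 3 × Site 3,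
        {c₀ : Site 3 × Site 3 × Site 3 | (∀ j, (m : ℤ) ∣ c₀.1 j) ∧ (∀ j, |c₀.2.1 j - c₀.1 j| ≤ 1) ∧
          (∀ j, |c₀.2.2 j - c₀.1 j| ≤ 1) ∧ R c₀.1}.indicator (fun c₀ => T (c₀.2.1 - s)) c₀ ≤
      729 * ∑' v : Site 3, g v := by
  classical
  rw [ENNReal.tsum_prod', ENNReal.tsum_comm, ENNReal.tsum_prod']
  -- `Σ_{a₀} Σ_{b₀} Σ_{x₀} ≤ Σ_{a₀} g(a₀ − s) · 27 · 27`
  have hpt : ∀ a₀ x₀ b₀ : Site 3,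
      {c₀ : Site 3 × Site 3 × Site 3 | (∀ j, (m : ℤ) ∣ c₀.1 j) ∧ (∀ j, |c₀.2.1 j - c₀.1 j| ≤ 1) ∧
          (∀ j, |c₀.2.2 j - c₀.1 j| ≤ 1) ∧ R c₀.1}.indicator (fun c₀ => T (c₀.2.1 - s)) (x₀, a₀, b₀) ≤
        g (a₀ - s) *
          ((if ∀ j, |a₀ j - x₀ j| ≤ 1 then (1 : ℝ≥0∞) else 0) * (if ∀ j, |b₀ j - x₀ j| ≤ 1 then (1 : ℝ≥0∞) else 0)) := by
    intro a₀ x₀ b₀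
    by_cases h : (∀ j, (m : ℤ) ∣ x₀ j) ∧ (∀ j, |a₀ j - x₀ j| ≤ 1) ∧ (∀ j, |b₀ j - x₀ j| ≤ 1) ∧ R x₀
    · rw [Set.indicator_of_mem (by exact h), if_pos h.2.1, if_pos h.2.2.1, mul_one, mul_one]
      exact hg x₀ a₀ h.1 h.2.1 h.2.2.2
    · rw [Set.indicator_of_notMem (by exact h)]
      exact zero_le
  have h729 : (27 : ℝ≥0∞) * 27 = 729 := by norm_num
  calc _ ≤ ∑' a₀ : Site 3, ∑' b₀ : Site 3, ∑' x₀ : Site 3, g (a₀ - s) *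
          ((if ∀ j, |a₀ j - x₀ j| ≤ 1 then (1 : ℝ≥0∞) else 0) * (if ∀ j, |b₀ j - x₀ j| ≤ 1 then (1 : ℝ≥0∞) else 0)) :=
        ENNReal.tsum_le_tsum fun a₀ => ENNReal.tsum_le_tsum fun b₀ => ENNReal.tsum_le_tsum fun x₀ => hpt a₀ x₀ b₀
    _ = ∑' a₀ : Site 3, g (a₀ - s) *
          ∑' x₀ : Site 3, ((if ∀ j, |a₀ j - x₀ j| ≤ 1 then (1 : ℝ≥0∞) else 0) *
            ∑' b₀ : Site 3, (if ∀ j, |b₀ j - x₀ j| ≤ 1 then (1 : ℝ≥0∞) else 0)) := by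
        refine tsum_congr fun a₀ => ?_
        rw [← ENNReal.tsum_mul_left, ENNReal.tsum_comm]
        refine tsum_congr fun x₀ => ?_
        rw [← ENNReal.tsum_mul_left, ← ENNReal.tsum_mul_left]
    _ ≤ ∑' a₀ : Site 3, g (a₀ - s) * (27 * 27) := by
        refine ENNReal.tsum_le_tsum fun a₀ => mul_le_mul_right ?_ _
        calc ∑' x₀ : Site 3, ((if ∀ j, |a₀ j - x₀ j| ≤ 1 then (1 : ℝ≥0∞) else 0) *
              ∑' b₀ : Site 3, (if ∀ j, |b₀ j - x₀ j| ≤ 1 then (1 : ℝ≥0∞) else 0))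
            ≤ ∑' x₀ : Site 3, ((if ∀ j, |a₀ j - x₀ j| ≤ 1 then (1 : ℝ≥0∞) else 0) * 27) :=
              ENNReal.tsum_le_tsum fun x₀ => mul_le_mul_right (tsum_indicator_cube_le x₀) _
          _ = (∑' x₀ : Site 3, (if ∀ j, |a₀ j - x₀ j| ≤ 1 then (1 : ℝ≥0∞) else 0)) * 27 := ENNReal.tsum_mul_right
          _ ≤ 27 * 27 := by
              refine mul_le_mul_left ?_ _
              refine le_trans (le_of_eq (tsum_congr fun x₀ => ?_)) (tsum_indicator_cube_le a₀)
              have hiff : (∀ j, |a₀ j - x₀ j| ≤ 1) ↔ (∀ j, |x₀ j - a₀ j| ≤ 1) :=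
                ⟨fun h j => by rw [abs_sub_comm]; exact h j, fun h j => by rw [abs_sub_comm]; exact h j⟩
              by_cases h : ∀ j, |a₀ j - x₀ j| ≤ 1
              · rw [if_pos h, if_pos (hiff.1 h)]
              · rw [if_neg h, if_neg (fun h' => h (hiff.2 h'))]
    _ = (∑' a₀ : Site 3, g (a₀ - s)) * (27 * 27) := ENNReal.tsum_mul_right
    _ = 729 * ∑' v : Site 3, g v := by
        rw [h729, mul_comm]
        congr 1
        exact (Equiv.subRight s).tsum_eq g

/-- **An inner link pays the tail**: for `s` in the cube of a decorated `x_p` (`m ≥ 3`), the total weight `T(a₀ − s)` over the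
first stars `(x₀, a₀, b₀)` with `x₀ ≠ x_p` decorated and `a₀, b₀ ∈ Q(x₀)` is at most `27 · 27 · Σ_{v ∉ Λ_{m−3}} T(v)`.
[cite: AizenmanNewman1984, §4] -/
theorem tsum_firstStar_le (T : Site 3 → ℝ≥0∞) {m : ℕ} (hm : 3 ≤ m) {xp s : Site 3} (hxp : ∀ j, (m : ℤ) ∣ xp j)
    (hs : ∀ j, |s j - xp j| ≤ 1) :
    ∑' c₀ : Site 3 × Site 3 × Site 3,
        {c₀ : Site 3 × Site 3 × Site 3 | (∀ j, (m : ℤ) ∣ c₀.1 j) ∧ (∀ j, |c₀.2.1 j - c₀.1 j| ≤ 1) ∧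
          (∀ j, |c₀.2.2 j - c₀.1 j| ≤ 1) ∧ c₀.1 ≠ xp}.indicator (fun c₀ => T (c₀.2.1 - s)) c₀ ≤
      729 * ∑' v : Site 3, (if v ∈ box 3 (m - 3) then 0 else T v) := by
  refine tsum_firstStar_le_of T _ m (· ≠ xp) s fun x₀ a₀ hx₀ ha hne => ?_
  rw [if_neg (not_mem_box_of_ne hm hxp hx₀ hne hs ha)]

/-- **The first link from an arbitrary start pays `27 · 27 · χ`** (`R` arbitrary). [folklore] -/
theorem tsum_firstStar_le_origin (T : Site 3 → ℝ≥0∞) (m : ℕ) (R : Site 3 → Prop) (s : Site 3) :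
    ∑' c₀ : Site 3 × Site 3 × Site 3,
        {c₀ : Site 3 × Site 3 × Site 3 | (∀ j, (m : ℤ) ∣ c₀.1 j) ∧ (∀ j, |c₀.2.1 j - c₀.1 j| ≤ 1) ∧
          (∀ j, |c₀.2.2 j - c₀.1 j| ≤ 1) ∧ R c₀.1}.indicator (fun c₀ => T (c₀.2.1 - s)) c₀ ≤
      729 * ∑' v : Site 3, T v :=
  tsum_firstStar_le_of T T m R s fun _ _ _ _ _ => le_rfl

/-! ### Level sums: the first-link recurrence and the geometric bound -/

/-- **First-link recurrence for the level sums.**  Splitting a chain of `k + 1` stars into its first star `(x₀, a₀, b₀)` and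
the remaining chain (whose first star must now differ from `x₀`):
`L_{k+1}(R; s) = Σ_{(x₀,a₀,b₀)} [x₀ ∈ mℤ³, a₀ b₀ ∈ Q(x₀), R x₀] T(a₀ − s) · L_k(· ≠ x₀; b₀)`. [cite: AizenmanNewman1984, §4] -/
theorem levelSum_succ (T : Site 3 → ℝ≥0∞) (m k : ℕ) (R : Site 3 → Prop) (s : Site 3) :
    (∑' c : Fin (k + 1) → Site 3 × Site 3 × Site 3, ∑' z : Site 3,
      {c : Fin (k + 1) → Site 3 × Site 3 × Site 3 |
          (∀ i, (∀ j, (m : ℤ) ∣ (c i).1 j) ∧ (∀ j, |(c i).2.1 j - (c i).1 j| ≤ 1) ∧ (∀ j, |(c i).2.2 j - (c i).1 j| ≤ 1)) ∧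
          (∀ (i : Fin (k + 1)) (h : i.1 + 1 < k + 1), (c i).1 ≠ (c ⟨i.1 + 1, h⟩).1) ∧
          (∀ h : 0 < k + 1, R (c ⟨0, h⟩).1)}.indicator
        (fun c => ∏ i : Fin (k + 2), T ((if h : i.1 < k + 1 then (c ⟨i.1, h⟩).2.1 else z) -
          (if _h : i.1 = 0 then s else (c ⟨i.1 - 1, by omega⟩).2.2))) c) =
    ∑' c₀ : Site 3 × Site 3 × Site 3,
      {c₀ : Site 3 × Site 3 × Site 3 | (∀ j, (m : ℤ) ∣ c₀.1 j) ∧ (∀ j, |c₀.2.1 j - c₀.1 j| ≤ 1) ∧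
          (∀ j, |c₀.2.2 j - c₀.1 j| ≤ 1) ∧ R c₀.1}.indicator (fun c₀ => T (c₀.2.1 - s)) c₀ *
      ∑' c : Fin k → Site 3 × Site 3 × Site 3, ∑' z : Site 3,
        {c : Fin k → Site 3 × Site 3 × Site 3 |
            (∀ i, (∀ j, (m : ℤ) ∣ (c i).1 j) ∧ (∀ j, |(c i).2.1 j - (c i).1 j| ≤ 1) ∧ (∀ j, |(c i).2.2 j - (c i).1 j| ≤ 1)) ∧
            (∀ (i : Fin k) (h : i.1 + 1 < k), (c i).1 ≠ (c ⟨i.1 + 1, h⟩).1) ∧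
            (∀ h : 0 < k, (c ⟨0, h⟩).1 ≠ c₀.1)}.indicator
          (fun c => ∏ i : Fin (k + 1), T ((if h : i.1 < k then (c ⟨i.1, h⟩).2.1 else z) -
            (if h : i.1 = 0 then c₀.2.2 else (c ⟨i.1 - 1, by omega⟩).2.2))) c := by
  classical
  rw [← (Fin.consEquiv fun _ : Fin (k + 1) => Site 3 × Site 3 × Site 3).tsum_eq, ENNReal.tsum_prod']
  refine tsum_congr fun c₀ => ?_
  rw [← ENNReal.tsum_mul_left]
  refine tsum_congr fun c => ?_
  rw [← ENNReal.tsum_mul_left]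
  refine tsum_congr fun z => ?_
  have hce : (Fin.consEquiv fun _ : Fin (k + 1) => Site 3 × Site 3 × Site 3) (c₀, c) =
      (Fin.cons c₀ c : Fin (k + 1) → Site 3 × Site 3 × Site 3) := rfl
  rw [hce]
  have hmem := chainCond_cons_iff (m := m) R c₀ c
  simp only [Set.indicator_apply, Set.mem_setOf_eq]
  by_cases hP : (∀ j, (m : ℤ) ∣ c₀.1 j) ∧ (∀ j, |c₀.2.1 j - c₀.1 j| ≤ 1) ∧ (∀ j, |c₀.2.2 j - c₀.1 j| ≤ 1) ∧ R c₀.1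
  · by_cases hC : ((∀ i, (∀ j, (m : ℤ) ∣ (c i).1 j) ∧ (∀ j, |(c i).2.1 j - (c i).1 j| ≤ 1) ∧
        (∀ j, |(c i).2.2 j - (c i).1 j| ≤ 1)) ∧
        (∀ (i : Fin k) (h : i.1 + 1 < k), (c i).1 ≠ (c ⟨i.1 + 1, h⟩).1) ∧ (∀ h : 0 < k, (c ⟨0, h⟩).1 ≠ c₀.1))
    · rw [if_pos (hmem.2 ⟨hP, hC⟩), if_pos hP, if_pos hC]
      exact chainWeight_cons T s z c₀ c
    · rw [if_neg (fun h => hC (hmem.1 h).2), if_neg hC, mul_zero]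
  · rw [if_neg (fun h => hP (hmem.1 h).1), if_neg hP, zero_mul]

/-- **The level-zero sum is the susceptibility**: with no star the chain weight is `T(z − s)`, summing to `Σ_v T(v)`.
[folklore] -/
theorem levelSum_zero (T : Site 3 → ℝ≥0∞) (m : ℕ) (R : Site 3 → Prop) (s : Site 3) :
    (∑' c : Fin 0 → Site 3 × Site 3 × Site 3, ∑' z : Site 3,
      {c : Fin 0 → Site 3 × Site 3 × Site 3 |
          (∀ i, (∀ j, (m : ℤ) ∣ (c i).1 j) ∧ (∀ j, |(c i).2.1 j - (c i).1 j| ≤ 1) ∧ (∀ j, |(c i).2.2 j - (c i).1 j| ≤ 1)) ∧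
          (∀ (i : Fin 0) (h : i.1 + 1 < 0), (c i).1 ≠ (c ⟨i.1 + 1, h⟩).1) ∧
          (∀ h : 0 < 0, R (c ⟨0, h⟩).1)}.indicator
        (fun c => ∏ i : Fin 1, T ((if h : i.1 < 0 then (c ⟨i.1, h⟩).2.1 else z) -
          (if _h : i.1 = 0 then s else (c ⟨i.1 - 1, by omega⟩).2.2))) c) =
    ∑' v : Site 3, T v := by
  classical
  rw [tsum_fintype, Fintype.sum_unique, ← (Equiv.subRight s).tsum_eq T]
  refine tsum_congr fun z => ?_
  rw [Set.indicator_of_mem (by exact ⟨fun i => i.elim0, fun i => i.elim0, fun h => absurd h (lt_irrefl 0)⟩),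
    Fin.prod_univ_one]
  rfl

/-- **Geometric bound for the level sums** (`m ≥ 3`): if `s` lies in the cube of a decorated `x_p`, the total weight of the
chains of `k` stars whose first star differs from `x_p`, summed over the chain and the endpoint, is at most
`χ (729 ε_m)^k`, `χ = Σ_v T(v)`, `ε_m = Σ_{v ∉ Λ_{m−3}} T(v)`. [cite: AizenmanNewman1984, §4] -/
theorem levelSum_le_pow (T : Site 3 → ℝ≥0∞) {m : ℕ} (hm : 3 ≤ m) :
    ∀ (k : ℕ) (xp s : Site 3), (∀ j, (m : ℤ) ∣ xp j) → (∀ j, |s j - xp j| ≤ 1) →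
      (∑' c : Fin k → Site 3 × Site 3 × Site 3, ∑' z : Site 3,
        {c : Fin k → Site 3 × Site 3 × Site 3 |
            (∀ i, (∀ j, (m : ℤ) ∣ (c i).1 j) ∧ (∀ j, |(c i).2.1 j - (c i).1 j| ≤ 1) ∧ (∀ j, |(c i).2.2 j - (c i).1 j| ≤ 1)) ∧
            (∀ (i : Fin k) (h : i.1 + 1 < k), (c i).1 ≠ (c ⟨i.1 + 1, h⟩).1) ∧
            (∀ h : 0 < k, (c ⟨0, h⟩).1 ≠ xp)}.indicator
          (fun c => ∏ i : Fin (k + 1), T ((if h : i.1 < k then (c ⟨i.1, h⟩).2.1 else z) -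
            (if _h : i.1 = 0 then s else (c ⟨i.1 - 1, by omega⟩).2.2))) c) ≤
      (∑' v : Site 3, T v) * (729 * ∑' v : Site 3, (if v ∈ box 3 (m - 3) then 0 else T v)) ^ k := by
  intro k
  induction k with
  | zero =>
      intro xp s _ _
      rw [pow_zero, mul_one]
      exact (levelSum_zero T m (· ≠ xp) s).le
  | succ k ih =>
      intro xp s hxp hs
      refine (levelSum_succ T m k (· ≠ xp) s).trans_le ?_
      calc _ ≤ ∑' c₀ : Site 3 × Site 3 × Site 3,
            {c₀ : Site 3 × Site 3 × Site 3 | (∀ j, (m : ℤ) ∣ c₀.1 j) ∧ (∀ j, |c₀.2.1 j - c₀.1 j| ≤ 1) ∧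
              (∀ j, |c₀.2.2 j - c₀.1 j| ≤ 1) ∧ c₀.1 ≠ xp}.indicator (fun c₀ => T (c₀.2.1 - s)) c₀ *
            ((∑' v : Site 3, T v) * (729 * ∑' v : Site 3, (if v ∈ box 3 (m - 3) then 0 else T v)) ^ k) := by
            refine ENNReal.tsum_le_tsum fun c₀ => ?_
            by_cases hP : (∀ j, (m : ℤ) ∣ c₀.1 j) ∧ (∀ j, |c₀.2.1 j - c₀.1 j| ≤ 1) ∧ (∀ j, |c₀.2.2 j - c₀.1 j| ≤ 1) ∧
                c₀.1 ≠ xp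
            · exact mul_le_mul_right (ih c₀.1 c₀.2.2 hP.1 hP.2.2.1) _
            · rw [Set.indicator_of_notMem (by exact hP), zero_mul, zero_mul]
        _ = (∑' c₀ : Site 3 × Site 3 × Site 3,
            {c₀ : Site 3 × Site 3 × Site 3 | (∀ j, (m : ℤ) ∣ c₀.1 j) ∧ (∀ j, |c₀.2.1 j - c₀.1 j| ≤ 1) ∧
              (∀ j, |c₀.2.2 j - c₀.1 j| ≤ 1) ∧ c₀.1 ≠ xp}.indicator (fun c₀ => T (c₀.2.1 - s)) c₀) *
            ((∑' v : Site 3, T v) * (729 * ∑' v : Site 3, (if v ∈ box 3 (m - 3) then 0 else T v)) ^ k) :=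
            ENNReal.tsum_mul_right
        _ ≤ (729 * ∑' v : Site 3, (if v ∈ box 3 (m - 3) then 0 else T v)) *
            ((∑' v : Site 3, T v) * (729 * ∑' v : Site 3, (if v ∈ box 3 (m - 3) then 0 else T v)) ^ k) :=
            mul_le_mul_left (tsum_firstStar_le T hm hxp hs) _
        _ = _ := by ring

/-- **Chains from the origin** (`m ≥ 3`): the total weight of the chains of `k + 1` stars starting at `s` (first star subject
only to an arbitrary `R`), summed over the chain and the endpoint, is at most `729 χ · χ (729 ε_m)^k`.
[cite: AizenmanNewman1984, §4] -/
theorem levelSum_succ_le (T : Site 3 → ℝ≥0∞) {m : ℕ} (hm : 3 ≤ m) (k : ℕ) (R : Site 3 → Prop) (s : Site 3) :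
    (∑' c : Fin (k + 1) → Site 3 × Site 3 × Site 3, ∑' z : Site 3,
      {c : Fin (k + 1) → Site 3 × Site 3 × Site 3 |
          (∀ i, (∀ j, (m : ℤ) ∣ (c i).1 j) ∧ (∀ j, |(c i).2.1 j - (c i).1 j| ≤ 1) ∧ (∀ j, |(c i).2.2 j - (c i).1 j| ≤ 1)) ∧
          (∀ (i : Fin (k + 1)) (h : i.1 + 1 < k + 1), (c i).1 ≠ (c ⟨i.1 + 1, h⟩).1) ∧
          (∀ h : 0 < k + 1, R (c ⟨0, h⟩).1)}.indicator
        (fun c => ∏ i : Fin (k + 2), T ((if h : i.1 < k + 1 then (c ⟨i.1, h⟩).2.1 else z) -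
          (if _h : i.1 = 0 then s else (c ⟨i.1 - 1, by omega⟩).2.2))) c) ≤
      (729 * ∑' v : Site 3, T v) *
        ((∑' v : Site 3, T v) * (729 * ∑' v : Site 3, (if v ∈ box 3 (m - 3) then 0 else T v)) ^ k) := by
  refine (levelSum_succ T m k R s).trans_le ?_
  calc _ ≤ ∑' c₀ : Site 3 × Site 3 × Site 3,
        {c₀ : Site 3 × Site 3 × Site 3 | (∀ j, (m : ℤ) ∣ c₀.1 j) ∧ (∀ j, |c₀.2.1 j - c₀.1 j| ≤ 1) ∧
          (∀ j, |c₀.2.2 j - c₀.1 j| ≤ 1) ∧ R c₀.1}.indicator (fun c₀ => T (c₀.2.1 - s)) c₀ *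
        ((∑' v : Site 3, T v) * (729 * ∑' v : Site 3, (if v ∈ box 3 (m - 3) then 0 else T v)) ^ k) := by
        refine ENNReal.tsum_le_tsum fun c₀ => ?_
        by_cases hP : (∀ j, (m : ℤ) ∣ c₀.1 j) ∧ (∀ j, |c₀.2.1 j - c₀.1 j| ≤ 1) ∧ (∀ j, |c₀.2.2 j - c₀.1 j| ≤ 1) ∧ R c₀.1
        · exact mul_le_mul_right (levelSum_le_pow T hm k c₀.1 c₀.2.2 hP.1 hP.2.2.1) _
        · rw [Set.indicator_of_notMem (by exact hP), zero_mul, zero_mul]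
    _ = (∑' c₀ : Site 3 × Site 3 × Site 3,
        {c₀ : Site 3 × Site 3 × Site 3 | (∀ j, (m : ℤ) ∣ c₀.1 j) ∧ (∀ j, |c₀.2.1 j - c₀.1 j| ≤ 1) ∧
          (∀ j, |c₀.2.2 j - c₀.1 j| ≤ 1) ∧ R c₀.1}.indicator (fun c₀ => T (c₀.2.1 - s)) c₀) *
        ((∑' v : Site 3, T v) * (729 * ∑' v : Site 3, (if v ∈ box 3 (m - 3) then 0 else T v)) ^ k) :=
        ENNReal.tsum_mul_right
    _ ≤ _ := mul_le_mul_left (tsum_firstStar_le_origin T m R s) _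

/-- The cube indicator sum is finite (re-commit corollary of `tsum_indicator_cube_le`). [folklore] -/
theorem tsum_indicator_cube_ne_top (a : Site 3) :
    ∑' x : Site 3, (if ∀ j, |x j - a j| ≤ 1 then (1 : ℝ≥0∞) else 0) ≠ ∞ :=
  ne_top_of_le_ne_top (by norm_num) (tsum_indicator_cube_le a)

end EnhancementThresholdLimit

end Summit.CriticalPhenomena.PercolationContinuityZ3.Theorems

end
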